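import Literature.Analysis.FunctionSpaces.BesovTranslation
import Literature.Analysis.FunctionSpaces.BesovLittlewoodPaleyApproximation
import Literature.Analysis.FunctionSpaces.BesovPairing
import Literature.Analysis.FunctionSpaces.LittlewoodPaleyConvergenceProofs
import Literature.Analysis.FunctionSpaces.BesovCriticalRescaling
import HarnessLib

/-!
# Far translates of a realised Besov distribution tend to zero in `𝓢'`

Analysis/FunctionSpaces proof file (theorems only: no definition, no named fact). For
`u ∈ Ḃ^s_{p,q}(ℝᵈ)` realised (`Ṡ_j u → 0`), `-2 < s < 0`, `p, q < ∞`, and every Schwartz `θ`,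
`⟨τ_b u, θ⟩ → 0` as `|b| → ∞` (`tendsto_distribTranslate_apply_cocompact_of_memHomBesov`). This is
the form in which "`u(· + x_n) ⇀ 0` for `|x_n| → ∞`" enters the far-field step of the blow-up
argument of W. Wang, Z. Zhang, Sci. China Math. 60 (2017) = arXiv:1510.02589, §4 Step 1 (the
spatial decay of `v`, used there through `v ∈ L^∞(-1,0; L⁴(ℝ³ \ B_R))`).

Proof: split `u = Ṡ_{j₀} u + (Ṡ_J u - Ṡ_{j₀} u) + (u - Ṡ_J u)`. The two tails are small in
`Ḃ^s_{p,q}` uniformly under translation (`tendsto_eHomBesovNorm_lowFreqCutoff_atBot`,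
`tendsto_eHomBesovNorm_sub_lowFreqCutoff_atTop`, `q < ∞`; translation invariance
`eHomBesovNorm_distribTranslate`), hence their pairings with `θ` are small (the embedding bound
`exists_nnnorm_apply_le_mul_eHomBesovNorm`, BCD Prop. 2.27); the middle piece is an `L^p` function
(`eLpNormDistrib_lowFreqCutoff_lt_top_of_neg`), and for `f ∈ L^p`, `p < ∞`,
`∫ θ(x + b) f(x) dx → 0` (approximation by continuous compactly supported functions and the decay
of `θ`; `tendsto_coe_Lp_distribTranslate_apply_cocompact`).

## References

* H. Bahouri, J.-Y. Chemin, R. Danchin, *Fourier Analysis and Nonlinear PDE* (2011), Prop. 2.18,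
  Prop. 2.27. [BahouriCheminDanchin2011]
* W. Wang, Z. Zhang, Sci. China Math. 60 (2017) = arXiv:1510.02589, §4 Step 1. [WangZhang2016]
-/

noncomputable section

open MeasureTheory Filter Topology Set Metric SchwartzMap TemperedDistribution
open scoped ENNReal NNReal SchwartzMap FourierTransform

namespace Literature.Analysis.FunctionSpaces

variable {E : Type*} [NormedAddCommGroup E] [InnerProductSpace ℝ E] [FiniteDimensional ℝ E]
  [MeasurableSpace E] [BorelSpace E]
  {F : Type*} [NormedAddCommGroup F] [NormedSpace ℂ F] [CompleteSpace F]

/-! ### `L^p` functions: far translates pair to zero with Schwartz functions -/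

omit [MeasurableSpace E] [BorelSpace E] in
/-- **Decay of a Schwartz function along far translates of a compact set**: for compact `K`,
`sup_{x ∈ K} ‖θ(x + b)‖ → 0` as `|b| → ∞`, in the form: for `ε > 0`, eventually (cocompact in
`b`) `‖θ(x + b)‖ ≤ ε` for all `x ∈ K`. [folklore] -/
theorem eventually_forall_norm_add_le_of_isCompact (θ : 𝓢(E, ℂ)) {K : Set E} (hK : IsCompact K)
    {ε : ℝ} (hε : 0 < ε) :
    ∀ᶠ b in cocompact E, ∀ x ∈ K, ‖θ (x + b)‖ ≤ ε := by
  obtain ⟨R, hR⟩ := hK.isBounded.subset_closedBall (0 : E)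
  obtain ⟨C, hCpos, hC⟩ := θ.decay 1 0
  have hC' : ∀ y : E, ‖y‖ * ‖θ y‖ ≤ C := fun y => by simpa using hC y
  -- for `‖b‖ ≥ R + C/ε + 1`: `‖x + b‖ ≥ ‖b‖ - R ≥ C/ε + 1`, so `‖θ(x+b)‖ ≤ C/‖x+b‖ < ε`
  have hmem : (closedBall (0 : E) (max R 0 + C / ε + 1))ᶜ ∈ cocompact E :=
    (isCompact_closedBall (0 : E) _).compl_mem_cocompact
  filter_upwards [hmem] with b hb x hx
  rw [mem_compl_iff, mem_closedBall, dist_zero_right, not_le] at hb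
  have hxR : ‖x‖ ≤ max R 0 := by
    have := hR hx
    rw [mem_closedBall, dist_zero_right] at this
    exact this.trans (le_max_left _ _)
  have hxb : C / ε + 1 < ‖x + b‖ := by
    have h1 : ‖b‖ ≤ ‖x + b‖ + ‖x‖ := by
      calc ‖b‖ = ‖(x + b) - x‖ := by rw [add_sub_cancel_left]
        _ ≤ ‖x + b‖ + ‖x‖ := norm_sub_le _ _
    linarith
  have hpos : 0 < ‖x + b‖ := lt_trans (by positivity) hxb
  have h2 : ‖θ (x + b)‖ ≤ C / ‖x + b‖ := by
    rw [le_div_iff₀ hpos, mul_comm]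
    exact hC' (x + b)
  refine h2.trans ?_
  rw [div_le_iff₀ hpos]
  have : C / ε * ε = C := div_mul_cancel₀ C hε.ne'
  nlinarith

/-- **For `f ∈ L^p`, `p < ∞`, the pairings of far translates of `f` with a Schwartz function
tend to zero**: `⟨τ_b f, θ⟩ = ∫ θ(x + b) f(x) dx → 0` as `|b| → ∞` (approximate `f` in `L^p` by a
continuous compactly supported `g`, Hölder for `f - g`, decay of `θ` on the far translates of the
support of `g`). [folklore] -/
theorem tendsto_coe_Lp_distribTranslate_apply_cocompact {p : ℝ≥0∞} [Fact (1 ≤ p)] (hp : p ≠ ⊤)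
    (f : Lp F p (volume : Measure E)) (θ : 𝓢(E, ℂ)) :
    Tendsto (fun b : E => distribTranslate F b (f : 𝓢'(E, F)) θ) (cocompact E) (𝓝 0) := by
  haveI hconj : p.HolderConjugate (1 - p⁻¹)⁻¹ :=
    ENNReal.HolderConjugate.inv_one_sub_inv' (Fact.out : 1 ≤ p)
  set q : ℝ≥0∞ := (1 - p⁻¹)⁻¹ with hq
  haveI : q.HolderConjugate p := ENNReal.HolderConjugate.symm
  rw [Metric.tendsto_nhds]
  intro ε hε
  -- the `L^{p'}` norm of `θ` (translation invariant)
  set A : ℝ := (eLpNorm (⇑θ) q (volume : Measure E)).toReal with hA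
  have hA0 : 0 ≤ A := ENNReal.toReal_nonneg
  -- approximate `f` by a continuous compactly supported `g`
  have hδ : (0 : ℝ≥0∞) < ENNReal.ofReal (ε / (2 * (A + 1))) := ENNReal.ofReal_pos.2 (by positivity)
  obtain ⟨g, hgsupp, hfg, hgcont, hgmem⟩ :=
    (Lp.memLp f).exists_hasCompactSupport_eLpNorm_sub_le hp hδ.ne'
  set gL : Lp F p (volume : Measure E) := hgmem.toLp g with hgL
  have hgLae : (gL : E → F) =ᵐ[volume] g := hgmem.coeFn_toLp
  -- the `L^p` distance of `f` and `gL`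
  have hdist : eLpNorm ((f - gL : Lp F p (volume : Measure E)) : E → F) p volume ≤
      ENNReal.ofReal (ε / (2 * (A + 1))) := by
    have h1 : ((f - gL : Lp F p (volume : Measure E)) : E → F) =ᵐ[volume]
        (f : E → F) - g := (Lp.coeFn_sub f gL).trans (EventuallyEq.rfl.sub hgLae)
    rw [eLpNorm_congr_ae h1]
    exact hfg
  -- ### the `g`-part: decay of `θ` on far translates of `tsupport g`
  set K : Set E := tsupport g with hKdef
  have hK : IsCompact K := hgsupp
  set Ig : ℝ := ∫ x, ‖g x‖ with hIg
  have hIg0 : 0 ≤ Ig := integral_nonneg fun x => norm_nonneg _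
  have hεg : 0 < ε / (2 * (Ig + 1)) := by positivity
  have hfar := eventually_forall_norm_add_le_of_isCompact θ hK hεg
  filter_upwards [hfar] with b hb
  rw [dist_zero_right]
  -- split the pairing
  have hcoe : (((f - gL : Lp F p (volume : Measure E))) : 𝓢'(E, F)) = (f : 𝓢'(E, F)) - (gL : 𝓢'(E, F)) := by
    have e := map_sub (Lp.toTemperedDistributionCLM F (volume : Measure E) p) f gL
    simpa only [Lp.toTemperedDistributionCLM_apply] using e
  have hsplit : distribTranslate F b (f : 𝓢'(E, F)) θ =
      distribTranslate F b ((f - gL : Lp F p (volume : Measure E)) : 𝓢'(E, F)) θ +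
        distribTranslate F b (gL : 𝓢'(E, F)) θ := by
    rw [← add_apply, ← map_add, hcoe, sub_add_cancel]
  rw [hsplit]
  -- the translated test function and its `L^{p'}` norm
  have hθb : ∀ x, (SchwartzMap.compSubConstCLM ℂ (-b) θ) x = θ (x + b) := fun x => by
    rw [SchwartzMap.compSubConstCLM_apply, sub_neg_eq_add]
  have hθbnorm : eLpNorm (⇑(SchwartzMap.compSubConstCLM ℂ (-b) θ)) q (volume : Measure E) =
      eLpNorm (⇑θ) q volume := by
    have e : (⇑(SchwartzMap.compSubConstCLM ℂ (-b) θ) : E → ℂ) = fun x => θ (x - (-b)) := by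
      funext x; rw [SchwartzMap.compSubConstCLM_apply]
    rw [e]
    exact eLpNorm_comp_sub_right q (⇑θ) θ.continuous.aestronglyMeasurable (-b)
  -- ### (a) the `L^p`-small part, by Hölder
  have ha : ‖distribTranslate F b ((f - gL : Lp F p (volume : Measure E)) : 𝓢'(E, F)) θ‖ < ε / 2 := by
    rw [distribTranslate_apply_apply]
    refine (norm_coe_Lp_apply_le (q := q) (f - gL) _).trans_lt ?_
    rw [hθbnorm, ENNReal.toReal_mul, ← hA]
    have h1 : (eLpNorm ((f - gL : Lp F p (volume : Measure E)) : E → F) p volume).toReal ≤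
        ε / (2 * (A + 1)) :=
      ENNReal.toReal_le_of_le_ofReal (by positivity) hdist
    calc A * (eLpNorm ((f - gL : Lp F p (volume : Measure E)) : E → F) p volume).toReal
        ≤ A * (ε / (2 * (A + 1))) := mul_le_mul_of_nonneg_left h1 hA0
      _ < (A + 1) * (ε / (2 * (A + 1))) := by gcongr; linarith
      _ = ε / 2 := by field_simp
  -- ### (b) the compactly supported part, by the decay of `θ`
  have hb' : ‖distribTranslate F b (gL : 𝓢'(E, F)) θ‖ ≤ ε / 2 := by
    rw [distribTranslate_apply_apply, Lp.toTemperedDistribution_apply]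
    have e : ∫ x, (SchwartzMap.compSubConstCLM ℂ (-b) θ) x • (gL : E → F) x =
        ∫ x, θ (x + b) • g x :=
      integral_congr_ae (hgLae.mono fun x hx => by
        show ((SchwartzMap.compSubConstCLM ℂ (-b) θ) x) • (gL : E → F) x = θ (x + b) • g x
        rw [hθb, hx])
    rw [e]
    have hpt : ∀ x, ‖θ (x + b) • g x‖ ≤ ε / (2 * (Ig + 1)) * ‖g x‖ := by
      intro x
      rw [norm_smul]
      by_cases hx : x ∈ K
      · exact mul_le_mul_of_nonneg_right (hb x hx) (norm_nonneg _)
      · have : g x = 0 := image_eq_zero_of_notMem_tsupport hx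
        rw [this, norm_zero, mul_zero, mul_zero]
    calc ‖∫ x, θ (x + b) • g x‖ ≤ ∫ x, ‖θ (x + b) • g x‖ := norm_integral_le_integral_norm _
      _ ≤ ∫ x, ε / (2 * (Ig + 1)) * ‖g x‖ := by
          refine integral_mono_of_nonneg (Eventually.of_forall fun x => norm_nonneg _) ?_
            (Eventually.of_forall hpt)
          exact (hgcont.integrable_of_hasCompactSupport hgsupp).norm.const_mul _
      _ = ε / (2 * (Ig + 1)) * Ig := by rw [integral_const_mul]
      _ ≤ ε / (2 * (Ig + 1)) * (Ig + 1) := by gcongr; linarith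
      _ = ε / 2 := by field_simp
  calc ‖distribTranslate F b ((f - gL : Lp F p (volume : Measure E)) : 𝓢'(E, F)) θ +
        distribTranslate F b (gL : 𝓢'(E, F)) θ‖
      ≤ ‖distribTranslate F b ((f - gL : Lp F p (volume : Measure E)) : 𝓢'(E, F)) θ‖ +
        ‖distribTranslate F b (gL : 𝓢'(E, F)) θ‖ := norm_add_le _ _
    _ < ε / 2 + ε / 2 := add_lt_add_of_lt_of_le ha hb'
    _ = ε := by ring

/-! ### Realised Besov distributions: far translates tend to zero in `𝓢'` -/

omit [NormedSpace ℂ F] [CompleteSpace F] in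
/-- From an extended bound `‖x‖₊ < ofReal c` to `‖x‖ < c`. [folklore] -/
theorem norm_lt_of_coe_nnnorm_lt_ofReal {x : F} {c : ℝ}
    (h : (‖x‖₊ : ℝ≥0∞) < ENNReal.ofReal c) : ‖x‖ < c := by
  rw [ENNReal.lt_ofReal_iff_toReal_lt ENNReal.coe_ne_top, ENNReal.coe_toReal, coe_nnnorm] at h
  exact h

/-- **Far translates of a realised `Ḃ^s_{p,q}` distribution tend to zero in `𝓢'`**
(`-2 < s < 0`, `1 ≤ p < ∞`, `0 < q < ∞`): `⟨τ_b u, θ⟩ → 0` as `|b| → ∞` for every Schwartz `θ`.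
Proof in the module docstring. [cite: BahouriCheminDanchin2011, Prop. 2.18, Prop. 2.27] -/
theorem tendsto_distribTranslate_apply_cocompact_of_memHomBesov {s : ℝ} (hs : -2 < s) (hs0 : s < 0)
    {p q : ℝ≥0∞} [Fact (1 ≤ p)] (hp : p ≠ ⊤) (hq₀ : q ≠ 0) (hq : q ≠ ⊤) {u : 𝓢'(E, F)}
    (hu : MemHomBesov s p q u) (θ : 𝓢(E, ℂ)) :
    Tendsto (fun b : E => distribTranslate F b u θ) (cocompact E) (𝓝 0) := by
  haveI : p.HolderConjugate (1 - p⁻¹)⁻¹ :=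
    ENNReal.HolderConjugate.inv_one_sub_inv' (Fact.out : 1 ≤ p)
  obtain ⟨Kθ, hKθ⟩ := exists_nnnorm_apply_le_mul_eHomBesovNorm (E := E) (F := F) p (1 - p⁻¹)⁻¹
    (σ := -s) (by linarith) (by linarith) θ
  simp only [neg_neg] at hKθ
  have hfin : eHomBesovNorm s p q u < ⊤ := hu.1
  have hfin' : eHomBesovNorm s p ∞ u < ⊤ := (eHomBesovNorm_top_le_eHomBesovNorm s p hq₀ u).trans_lt hfin
  rw [Metric.tendsto_nhds]
  intro ε hε
  set ε₃ : ℝ≥0∞ := ENNReal.ofReal (ε / 3) with hε₃def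
  have hε₃ : (0 : ℝ≥0∞) < ε₃ := ENNReal.ofReal_pos.2 (by positivity)
  have hK0 : (Kθ : ℝ≥0∞) * 0 < ε₃ := by rw [mul_zero]; exact hε₃
  -- ### the tails
  obtain ⟨J, hJ⟩ : ∃ J : ℤ, (Kθ : ℝ≥0∞) * eHomBesovNorm s p q (u - lowFreqCutoff J u) < ε₃ :=
    ((ENNReal.Tendsto.const_mul (tendsto_eHomBesovNorm_sub_lowFreqCutoff_atTop hq₀ hq hfin)
      (Or.inr ENNReal.coe_ne_top)).eventually (gt_mem_nhds hK0)).exists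
  obtain ⟨j₀, hj₀⟩ : ∃ j₀ : ℤ, (Kθ : ℝ≥0∞) * eHomBesovNorm s p q (lowFreqCutoff j₀ u) < ε₃ :=
    ((ENNReal.Tendsto.const_mul (tendsto_eHomBesovNorm_lowFreqCutoff_atBot hq₀ hq hfin)
      (Or.inr ENNReal.coe_ne_top)).eventually (gt_mem_nhds hK0)).exists
  -- ### the middle piece is an `L^p` function
  obtain ⟨f₁, hf₁⟩ := exists_coe_eq_of_eLpNormDistrib_lt_top
    (eLpNormDistrib_lowFreqCutoff_lt_top_of_neg hs0 J hu.2 hfin')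
  obtain ⟨f₂, hf₂⟩ := exists_coe_eq_of_eLpNormDistrib_lt_top
    (eLpNormDistrib_lowFreqCutoff_lt_top_of_neg hs0 j₀ hu.2 hfin')
  have hmid : Tendsto (fun b : E => distribTranslate F b (lowFreqCutoff J u - lowFreqCutoff j₀ u) θ)
      (cocompact E) (𝓝 0) := by
    have e : lowFreqCutoff J u - lowFreqCutoff j₀ u = ((f₁ - f₂ : Lp F p (volume : Measure E)) : 𝓢'(E, F)) := by
      have e' := map_sub (Lp.toTemperedDistributionCLM F (volume : Measure E) p) f₁ f₂
      simp only [Lp.toTemperedDistributionCLM_apply] at e'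
      rw [e', hf₁, hf₂]
    rw [e]
    exact tendsto_coe_Lp_distribTranslate_apply_cocompact hp (f₁ - f₂) θ
  filter_upwards [(Metric.tendsto_nhds.1 hmid) (ε / 3) (by positivity)] with b hb
  rw [dist_zero_right] at hb ⊢
  -- ### the decomposition
  have hdec : distribTranslate F b u θ = distribTranslate F b (lowFreqCutoff j₀ u) θ +
      distribTranslate F b (lowFreqCutoff J u - lowFreqCutoff j₀ u) θ +
        distribTranslate F b (u - lowFreqCutoff J u) θ := by
    rw [← add_apply, ← add_apply, ← map_add, ← map_add]
    congr 2
    abel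
  -- ### the two tails under translation
  have htail₁ : ‖distribTranslate F b (u - lowFreqCutoff J u) θ‖ < ε / 3 := by
    have hreal := tendsto_lowFreqCutoff_distribTranslate_atBot
      (tendsto_lowFreqCutoff_sub_lowFreqCutoff_atBot u J) b (F := F)
    have h1 := hKθ _ hreal
    rw [eHomBesovNorm_distribTranslate] at h1
    refine norm_lt_of_coe_nnnorm_lt_ofReal (h1.trans_lt ?_)
    exact (mul_le_mul' le_rfl (eHomBesovNorm_top_le_eHomBesovNorm s p hq₀ _)).trans_lt hJ
  have htail₂ : ‖distribTranslate F b (lowFreqCutoff j₀ u) θ‖ < ε / 3 := by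
    have hreal := tendsto_lowFreqCutoff_distribTranslate_atBot
      (tendsto_lowFreqCutoff_lowFreqCutoff_atBot' hu.2 j₀) b (F := F)
    have h1 := hKθ _ hreal
    rw [eHomBesovNorm_distribTranslate] at h1
    refine norm_lt_of_coe_nnnorm_lt_ofReal (h1.trans_lt ?_)
    exact (mul_le_mul' le_rfl (eHomBesovNorm_top_le_eHomBesovNorm s p hq₀ _)).trans_lt hj₀
  rw [hdec]
  calc ‖distribTranslate F b (lowFreqCutoff j₀ u) θ +
        distribTranslate F b (lowFreqCutoff J u - lowFreqCutoff j₀ u) θ +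
          distribTranslate F b (u - lowFreqCutoff J u) θ‖
      ≤ ‖distribTranslate F b (lowFreqCutoff j₀ u) θ‖ +
        ‖distribTranslate F b (lowFreqCutoff J u - lowFreqCutoff j₀ u) θ‖ +
          ‖distribTranslate F b (u - lowFreqCutoff J u) θ‖ := norm_add₃_le
    _ < ε / 3 + ε / 3 + ε / 3 := by gcongr
    _ = ε := by ring

end Literature.Analysis.FunctionSpaces

end
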